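import Literature.Analysis.FluidPDE.LerayProjector
import Mathlib.Analysis.Fourier.LpSpace
import Mathlib.MeasureTheory.Function.Holder
import HarnessLib

/-!
# Fourier-side tools for the symbol of the Leray projector

Support file for the discharge of the named fact
`Literature.Analysis.FluidPDE.fourier_lerayProjector_schwartz` (`LerayProjector.lean`;
Lemarié-Rieusset 2002, Ch. 11 / Lemarié-Rieusset 2016, §6.3: the Leray projector is the Fourier
multiplier `I − ξ ⊗ ξ/|ξ|²`), proved in `LerayProjectorProofs.lean`.

Let `E` be a finite-dimensional real inner product space. For `u ∈ L²(E; E)` and `w ∈ E` the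
complexified component `x ↦ (⟪w, u x⟫ : ℂ)` is the `L²(E; ℂ)` class
`(Complex.ofRealCLM.comp (innerSL ℝ w)).compLp u`, and its `L²` Fourier transform (Mathlib's
Plancherel isometry `MeasureTheory.Lp.fourierTransformₗᵢ`) is the object the named fact speaks
about. This file provides (all **proved**, no definitions):

* `fourierTransform_compLp_eq_toLp`, `coeFn_fourierTransform_compLp_of_ae_eq`: if the component
  has a Schwartz representative `ψ`, its `L²` Fourier transform is the class of `𝓕 ψ`
  (Mathlib `SchwartzMap.toLp_fourier_eq`);
* `fourier_lineDerivOp_apply`: `𝓕(∂ₘψ)(ξ) = 2πi ⟪ξ, m⟫ 𝓕ψ(ξ)` pointwise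
  (Mathlib `SchwartzMap.fourier_lineDerivOp_eq`);
* `ae_sum_inner_mul_fourier_eq_zero_of_mem_topologicalClosure`: **linear symbol constraints pass
  to `L²` closures** — if every `v` in a set `S ⊆ L²(E; E)` satisfies
  `Σₖ ⟪ξ, aₖ⟫ 𝓕(⟪cₖ, v⟫)(ξ) = 0` for a.e. `ξ`, so does every element of the closed span of `S`
  (the weights `⟪ξ, aₖ⟫/(1 + ‖ξ‖²)` are bounded, so the constraint is the kernel of a continuous
  linear map `L²(E; E) → L²(E; ℂ)`, Hölder `L∞ · L² ⊆ L²`);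
* Schwartz representatives of components of test fields and of test scalars
  (`exists_schwartzMap_coe_eq_inner`, `exists_schwartzMap_coe_eq_ofReal`), their line
  derivatives, the Fourier-side incompressibility `Σᵢ ⟪ξ, bᵢ⟫ 𝓕φᵢ(ξ) = 0` of a divergence-free
  test field (`sum_inner_mul_fourier_eq_zero_of_isDivFree`), gradients as line derivatives
  (`inner_gradient_eq_lineDerivOp`), and the expansion of `𝓕(x ↦ ⟪w, P̂(ξ) φ(x)⟫)(ξ)` in an
  orthonormal frame (`fourier_inner_leraySymbol_eq`).

## Mathlib / tree search

Mathlib (pin `v4.32.0`): `MeasureTheory.Lp.fourierTransformₗᵢ`, `SchwartzMap.toLp_fourier_eq`,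
`HasCompactSupport.toSchwartzMap`, `SchwartzMap.fourier_lineDerivOp_eq`,
`SchwartzMap.lineDerivOp_apply_eq_fderiv`, the Hölder action `Lp 𝕜 ∞ • Lp E 2`
(`MeasureTheory.Lp.coeFn_lpSMul`, `Lp.norm_smul_le`), `Submodule.topologicalClosure_minimal`,
`ContinuousLinearMap.isClosed_ker`. Tree: `leraySymbol`, `leraySymbol_apply`
(`LerayProjector.lean`), `divergence_eq_sum_inner_fderiv` (`VectorCalculus.lean`). The
coordinate (`EuclideanSpace`) analogues `FujitaKato.compSchwartz`, `FujitaKato.scalarSchwartz`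
(`FujitaKatoTestFields.lean`) live on `ℝ^ι` with a heavy import chain; the coordinate-free
statements here are what the whole-space Leray projector on a general `E` needs.

## References

* P. G. Lemarié-Rieusset, *The Navier–Stokes Problem in the 21st Century*, CRC Press 2016,
  §6.3, Def. 6.4 and the remark following it (for `F₀ ∈ L²`, `ℙF₀` is the orthogonal projection
  onto `L²_σ`), Prop. 6.2 (`ℙ = Id − ∇Δ⁻¹div` via Riesz transforms). Bib key
  `LemarieRieusset2016`.
* P. G. Lemarié-Rieusset, *Recent developments in the Navier–Stokes problem*, Chapman &
  Hall/CRC 2002, Ch. 11. Bib key `LemarieRieusset2002`.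
-/

noncomputable section

open MeasureTheory TopologicalSpace Filter FourierTransform
open scoped InnerProductSpace RealInnerProductSpace ENNReal SchwartzMap LineDeriv Real

namespace Literature.Analysis.FluidPDE

variable {E : Type*} [NormedAddCommGroup E] [InnerProductSpace ℝ E] [FiniteDimensional ℝ E]
  [MeasurableSpace E] [BorelSpace E]

/-! ### The `L²` Fourier transform of a complexified component -/

/-- If the complexified `w`-component `x ↦ (⟪w, u x⟫ : ℂ)` of `u ∈ L²(E; E)` is represented by a
Schwartz function `ψ`, then its `L²` Fourier transform is the `L²` class of `𝓕 ψ` (the `L²`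
Fourier transform extends the Schwartz one; Mathlib `SchwartzMap.toLp_fourier_eq`). [folklore] -/
theorem fourierTransform_compLp_eq_toLp {u : Lp E 2 (volume : Measure E)} {w : E} (ψ : 𝓢(E, ℂ))
    (h : ∀ᵐ x ∂(volume : Measure E), ((⟪w, (u : E → E) x⟫ : ℝ) : ℂ) = ψ x) :
    Lp.fourierTransformₗᵢ E ℂ ((Complex.ofRealCLM.comp (innerSL ℝ w)).compLp u) = (𝓕 ψ).toLp 2 := by
  have h1 : (Complex.ofRealCLM.comp (innerSL ℝ w)).compLp u = ψ.toLp 2 := by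
    refine Lp.ext ?_
    filter_upwards [(Complex.ofRealCLM.comp (innerSL ℝ w)).coeFn_compLp u,
      ψ.coeFn_toLp 2 (volume : Measure E), h] with x h1 h2 h3
    rw [h1, h2, ← h3]
    rfl
  rw [h1]
  exact SchwartzMap.toLp_fourier_eq ψ

/-- A.e. form of `fourierTransform_compLp_eq_toLp`: the `L²` Fourier transform of a component
with Schwartz representative `ψ` is a.e. equal to `𝓕 ψ`. [folklore] -/
theorem coeFn_fourierTransform_compLp_of_ae_eq {u : Lp E 2 (volume : Measure E)} {w : E}
    (ψ : 𝓢(E, ℂ)) (h : ∀ᵐ x ∂(volume : Measure E), ((⟪w, (u : E → E) x⟫ : ℝ) : ℂ) = ψ x) :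
    ((Lp.fourierTransformₗᵢ E ℂ ((Complex.ofRealCLM.comp (innerSL ℝ w)).compLp u) :
        Lp ℂ 2 (volume : Measure E)) : E → ℂ) =ᵐ[volume] (𝓕 ψ : 𝓢(E, ℂ)) := by
  rw [fourierTransform_compLp_eq_toLp ψ h]
  exact (𝓕 ψ).coeFn_toLp 2 (volume : Measure E)

/-- `𝓕(∂ₘ ψ)(ξ) = 2πi ⟪ξ, m⟫ 𝓕ψ(ξ)` for a Schwartz function `ψ` (pointwise form of Mathlib's
`SchwartzMap.fourier_lineDerivOp_eq`). [folklore] -/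
theorem fourier_lineDerivOp_apply (ψ : 𝓢(E, ℂ)) (m ξ : E) :
    𝓕 (∂_{m} ψ) ξ = 2 * π * Complex.I * ((⟪ξ, m⟫ : ℝ) : ℂ) * 𝓕 ψ ξ := by
  rw [SchwartzMap.fourier_lineDerivOp_eq, smul_apply,
    SchwartzMap.smulLeftCLM_apply_apply (Function.hasTemperateGrowth_inner_left m)]
  simp only [smul_eq_mul, Complex.real_smul]
  ring

/-! ### Linear symbol constraints pass to `L²` closures -/

/-- **Linear symbol constraints pass to `L²` closures.** Let `a, c : κ → E` be finitely many
vectors and `S ⊆ L²(E; E)`. If for every `v ∈ S` the `L²` Fourier transforms of the components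
`⟪cₖ, v⟫` satisfy `Σₖ ⟪ξ, aₖ⟫ 𝓕(⟪cₖ, v⟫)(ξ) = 0` for a.e. `ξ`, then the same holds for every `u`
in the closed span of `S`. Proof: with the bounded weights `mₖ(ξ) = ⟪ξ, aₖ⟫ / (1 + ‖ξ‖²)` the
constraint is `Λ u = 0` for the continuous linear map `Λ u = Σₖ mₖ · 𝓕(⟪cₖ, u⟫)`
(`L²(E; E) → L²(E; ℂ)`, Hölder `L∞ · L² ⊆ L²` and Plancherel), whose kernel is a closed subspace.
This is the standard way symbol identities for smooth fields (`ξ · φ̂ = 0` for `div φ = 0`,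
`ξ ∧ ∇̂q = 0`) are transported to `L²_σ` and to the `L²` gradients. [folklore] -/
theorem ae_sum_inner_mul_fourier_eq_zero_of_mem_topologicalClosure {κ : Type*} [Fintype κ]
    (a c : κ → E) {S : Set (Lp E 2 (volume : Measure E))}
    (hS : ∀ v ∈ S, ∀ᵐ ξ ∂(volume : Measure E), ∑ k, ((⟪ξ, a k⟫ : ℝ) : ℂ) *
      ((Lp.fourierTransformₗᵢ E ℂ ((Complex.ofRealCLM.comp (innerSL ℝ (c k))).compLp v) :
        Lp ℂ 2 (volume : Measure E)) : E → ℂ) ξ = 0)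
    {u : Lp E 2 (volume : Measure E)} (hu : u ∈ (Submodule.span ℝ S).topologicalClosure) :
    ∀ᵐ ξ ∂(volume : Measure E), ∑ k, ((⟪ξ, a k⟫ : ℝ) : ℂ) *
      ((Lp.fourierTransformₗᵢ E ℂ ((Complex.ofRealCLM.comp (innerSL ℝ (c k))).compLp u) :
        Lp ℂ 2 (volume : Measure E)) : E → ℂ) ξ = 0 := by
  -- the component Fourier transforms as continuous `ℝ`-linear maps
  obtain ⟨T, hT⟩ : ∃ T : κ → (Lp E 2 (volume : Measure E) →L[ℝ] Lp ℂ 2 (volume : Measure E)),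
      ∀ k v, T k v =
        Lp.fourierTransformₗᵢ E ℂ ((Complex.ofRealCLM.comp (innerSL ℝ (c k))).compLp v) :=
    ⟨fun k => (((Lp.fourierTransformₗᵢ E ℂ).toContinuousLinearEquiv :
        Lp ℂ 2 (volume : Measure E) →L[ℂ] Lp ℂ 2 (volume : Measure E)).restrictScalars ℝ).comp
      ((Complex.ofRealCLM.comp (innerSL ℝ (c k))).compLpL 2 (volume : Measure E)),
      fun _ _ => rfl⟩
  -- bounded weights `m_k(ξ) = ⟪ξ, a k⟫ / (1 + ‖ξ‖²)`
  set m : κ → E → ℂ := fun k ξ => ((⟪ξ, a k⟫ / (1 + ‖ξ‖ ^ 2) : ℝ) : ℂ) with hm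
  have hm_cont : ∀ k, Continuous (m k) := fun k =>
    Complex.continuous_ofReal.comp ((continuous_id.inner continuous_const).div
      (continuous_const.add (continuous_norm.pow 2)) fun ξ => by positivity)
  have hm_bd : ∀ k ξ, ‖m k ξ‖ ≤ ‖a k‖ := by
    intro k ξ
    have hpos : (0 : ℝ) < 1 + ‖ξ‖ ^ 2 := by positivity
    rw [hm, Complex.norm_real, Real.norm_eq_abs, abs_div, abs_of_pos hpos, div_le_iff₀ hpos]
    calc |⟪ξ, a k⟫| ≤ ‖ξ‖ * ‖a k‖ := abs_real_inner_le_norm ξ (a k)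
      _ ≤ (1 + ‖ξ‖ ^ 2) * ‖a k‖ := by
          apply mul_le_mul_of_nonneg_right _ (norm_nonneg _)
          nlinarith [sq_nonneg (‖ξ‖ - 1), norm_nonneg ξ]
      _ = ‖a k‖ * (1 + ‖ξ‖ ^ 2) := mul_comm _ _
  have hm_mem : ∀ k, MemLp (m k) ∞ (volume : Measure E) := fun k =>
    memLp_top_of_bound (hm_cont k).aestronglyMeasurable ‖a k‖ (Eventually.of_forall (hm_bd k))
  -- the weighted identity `Σ ⟪ξ, aₖ⟫ Tₖ = (1 + ‖ξ‖²) Σ mₖ Tₖ`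
  have hweight : ∀ (ξ : E) (t : κ → ℂ), ∑ k, ((⟪ξ, a k⟫ : ℝ) : ℂ) * t k =
      ((1 + ‖ξ‖ ^ 2 : ℝ) : ℂ) * ∑ k, m k ξ * t k := by
    intro ξ t
    have hpos : (0 : ℝ) < 1 + ‖ξ‖ ^ 2 := by positivity
    rw [Finset.mul_sum]
    refine Finset.sum_congr rfl fun k _ => ?_
    rw [hm, ← mul_assoc, ← Complex.ofReal_mul, mul_div_cancel₀ _ hpos.ne']
  -- multiplication by the weights (Hölder `L∞ · L² ⊆ L²`)
  obtain ⟨M, hM⟩ : ∃ M : κ → (Lp ℂ 2 (volume : Measure E) →L[ℝ] Lp ℂ 2 (volume : Measure E)),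
      ∀ k f, M k f = (hm_mem k).toLp (m k) • f :=
    ⟨fun k => LinearMap.mkContinuous
      { toFun := fun f => (hm_mem k).toLp (m k) • f
        map_add' := fun f g => Lp.add_smul _ f g
        map_smul' := fun r f => (Lp.smul_comm r _ f).symm }
      ‖(hm_mem k).toLp (m k)‖ (fun f => Lp.norm_smul_le _ f), fun _ _ => rfl⟩
  -- the constraint operator `Λ = Σₖ Mₖ ∘ Tₖ`
  obtain ⟨Λ, hΛ⟩ : ∃ Λ : Lp E 2 (volume : Measure E) →L[ℝ] Lp ℂ 2 (volume : Measure E),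
      ∀ v, Λ v = ∑ k, (hm_mem k).toLp (m k) • T k v :=
    ⟨∑ k, (M k).comp (T k), fun v => by
      simp only [sum_apply, ContinuousLinearMap.comp_apply, hM]⟩
  have hcoe : ∀ v : Lp E 2 (volume : Measure E), (Λ v : E → ℂ) =ᵐ[volume]
      fun ξ => ∑ k, m k ξ * ((Lp.fourierTransformₗᵢ E ℂ
        ((Complex.ofRealCLM.comp (innerSL ℝ (c k))).compLp v) : Lp ℂ 2 (volume : Measure E)) :
          E → ℂ) ξ := by
    intro v
    rw [hΛ v]
    filter_upwards [Lp.coeFn_fun_finsetSum Finset.univ (fun k => (hm_mem k).toLp (m k) • T k v),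
      ae_all_iff.2 fun k => Lp.coeFn_lpSMul (r := 2) ((hm_mem k).toLp (m k)) (T k v),
      ae_all_iff.2 fun k => (hm_mem k).coeFn_toLp] with ξ h1 h2 h3
    rw [h1]
    refine Finset.sum_congr rfl fun k _ => ?_
    rw [h2 k, Pi.smul_apply', h3 k, smul_eq_mul, hT]
  -- `Λ v = 0` iff the constraint holds a.e.
  have hiff : ∀ v : Lp E 2 (volume : Measure E), Λ v = 0 ↔
      ∀ᵐ ξ ∂(volume : Measure E), ∑ k, ((⟪ξ, a k⟫ : ℝ) : ℂ) * ((Lp.fourierTransformₗᵢ E ℂ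
        ((Complex.ofRealCLM.comp (innerSL ℝ (c k))).compLp v) : Lp ℂ 2 (volume : Measure E)) :
          E → ℂ) ξ = 0 := by
    intro v
    rw [Lp.eq_zero_iff_ae_eq_zero]
    constructor
    · intro h0
      filter_upwards [h0, hcoe v] with ξ h1 h2
      rw [hweight, ← h2, h1, Pi.zero_apply, mul_zero]
    · intro h
      filter_upwards [h, hcoe v] with ξ h1 h2
      rw [h2, Pi.zero_apply]
      have hpos : (0 : ℝ) < 1 + ‖ξ‖ ^ 2 := by positivity
      rw [hweight] at h1
      exact (mul_eq_zero.1 h1).resolve_left (Complex.ofReal_ne_zero.2 hpos.ne')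
  rw [← hiff]
  have hle : (Submodule.span ℝ S).topologicalClosure ≤ Λ.ker := by
    refine Submodule.topologicalClosure_minimal _ (Submodule.span_le.2 fun v hv => ?_) Λ.isClosed_ker
    rw [SetLike.mem_coe, LinearMap.mem_ker, ContinuousLinearMap.coe_coe]
    exact (hiff v).2 (hS v hv)
  exact LinearMap.mem_ker.1 (hle hu)

/-! ### Test fields and test scalars on the Schwartz side -/

section TestField

variable {φ : E → E}

omit [FiniteDimensional ℝ E] [MeasurableSpace E] [BorelSpace E] in
/-- The complexified `w`-component `x ↦ (⟪w, φ x⟫ : ℂ)` of a smooth compactly supported field is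
a Schwartz function (Mathlib `HasCompactSupport.toSchwartzMap`). [folklore] -/
theorem exists_schwartzMap_coe_eq_inner (hφ : FunctionSpaces.IsTestFunctionOn (⊤ : Opens E) φ)
    (w : E) : ∃ ψ : 𝓢(E, ℂ), ∀ x, ψ x = ((⟪w, φ x⟫ : ℝ) : ℂ) :=
  ⟨(hφ.hasCompactSupport.comp_left (g := fun a : E => ((⟪w, a⟫ : ℝ) : ℂ)) (by simp)).toSchwartzMap
    ((Complex.ofRealCLM.comp (innerSL ℝ w)).contDiff.comp hφ.contDiff), fun _ => rfl⟩

omit [FiniteDimensional ℝ E] [MeasurableSpace E] [BorelSpace E] in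
/-- Line derivatives of a component: if `ψ = (⟪w, φ⟫ : ℂ)` then `∂ₘψ(x) = ⟪w, Dφ(x) m⟫` (chain
rule). [folklore] -/
theorem lineDerivOp_apply_of_coe_eq_inner (hφ : Differentiable ℝ φ) {w : E} {ψ : 𝓢(E, ℂ)}
    (hψ : ∀ x, ψ x = ((⟪w, φ x⟫ : ℝ) : ℂ)) (m x : E) :
    ∂_{m} ψ x = ((⟪w, fderiv ℝ φ x m⟫ : ℝ) : ℂ) := by
  rw [SchwartzMap.lineDerivOp_apply_eq_fderiv]
  have hcoe : ⇑ψ = ⇑(Complex.ofRealCLM.comp (innerSL ℝ w)) ∘ φ := funext fun x => (hψ x).trans rfl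
  rw [hcoe, ((Complex.ofRealCLM.comp (innerSL ℝ w)).hasFDerivAt.comp x (hφ x).hasFDerivAt).fderiv]
  rfl

/-- **Incompressibility on the Fourier side** for a divergence-free `C¹` field with Schwartz
components `ψᵢ = (⟪bᵢ, φ⟫ : ℂ)`: `Σᵢ ⟪ξ, bᵢ⟫ 𝓕ψᵢ(ξ) = 0`, since
`2πi Σᵢ ⟪ξ, bᵢ⟫ 𝓕ψᵢ = 𝓕(Σᵢ ∂ᵢψᵢ) = 𝓕(div φ) = 0` (Lemarié-Rieusset 2016, §6.3: `ℙF₀ = F₀` for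
`div F₀ = 0`, Fourier form). [cite: LemarieRieusset2016, §6.3 Def. 6.4 and remark] -/
theorem sum_inner_mul_fourier_eq_zero_of_isDivFree {ι : Type*} [Fintype ι]
    (b : OrthonormalBasis ι ℝ E) (hφ : Differentiable ℝ φ) (hdiv : VectorCalculus.IsDivFree φ)
    (ψ : ι → 𝓢(E, ℂ)) (hψ : ∀ i x, ψ i x = ((⟪b i, φ x⟫ : ℝ) : ℂ)) (ξ : E) :
    ∑ i, ((⟪ξ, b i⟫ : ℝ) : ℂ) * 𝓕 (ψ i) ξ = 0 := by
  have hsum : ∑ i, ∂_{b i} (ψ i) = 0 := by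
    ext x
    rw [sum_apply, zero_apply,
      Finset.sum_congr rfl fun i _ => lineDerivOp_apply_of_coe_eq_inner hφ (hψ i) (b i) x,
      ← Complex.ofReal_sum, ← divergence_eq_sum_inner_fderiv b φ x, hdiv x, Complex.ofReal_zero]
  have h : ∑ i, 𝓕 (∂_{b i} (ψ i)) ξ = 0 := by
    rw [← sum_apply, ← FourierTransform.fourier_sum, hsum, FourierTransform.fourier_zero,
      zero_apply]
  have h2 : ∑ i, 𝓕 (∂_{b i} (ψ i)) ξ =
      (2 * π * Complex.I) * ∑ i, ((⟪ξ, b i⟫ : ℝ) : ℂ) * 𝓕 (ψ i) ξ := by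
    rw [Finset.mul_sum]
    refine Finset.sum_congr rfl fun i _ => ?_
    rw [fourier_lineDerivOp_apply]
    ring
  rw [h2] at h
  have hc : (2 * π * Complex.I : ℂ) ≠ 0 :=
    mul_ne_zero (mul_ne_zero two_ne_zero (Complex.ofReal_ne_zero.2 Real.pi_ne_zero))
      Complex.I_ne_zero
  exact (mul_eq_zero.1 h).resolve_left hc

/-- Expansion of the Fourier integral of `x ↦ ⟪w, P̂(ξ) φ(x)⟫` at the frequency `ξ` in an
orthonormal frame `b`: with `P̂(ξ) a = a − |ξ|⁻² ⟪ξ, a⟫ ξ` (`leraySymbol_apply`) and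
`⟪ξ, a⟫ = Σᵢ ⟪ξ, bᵢ⟫⟪bᵢ, a⟫`,
`𝓕(⟪w, P̂(ξ)φ⟫)(ξ) = 𝓕ψ_w(ξ) − |ξ|⁻² ⟪w, ξ⟫ Σᵢ ⟪ξ, bᵢ⟫ 𝓕ψᵢ(ξ)` for Schwartz representatives
`ψ_w = (⟪w, φ⟫ : ℂ)`, `ψᵢ = (⟪bᵢ, φ⟫ : ℂ)` (linearity of the Fourier transform on `𝓢`). [cite: LemarieRieusset2016, §6.3 Prop. 6.2] -/
theorem fourier_inner_leraySymbol_eq {ι : Type*} [Fintype ι] (b : OrthonormalBasis ι ℝ E)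
    (w ξ : E) {ψw : 𝓢(E, ℂ)} (hψw : ∀ x, ψw x = ((⟪w, φ x⟫ : ℝ) : ℂ)) {ψ : ι → 𝓢(E, ℂ)}
    (hψ : ∀ i x, ψ i x = ((⟪b i, φ x⟫ : ℝ) : ℂ)) :
    𝓕 (fun x => ((⟪w, leraySymbol ξ (φ x)⟫ : ℝ) : ℂ)) ξ =
      𝓕 ψw ξ - (((‖ξ‖ ^ 2)⁻¹ * ⟪w, ξ⟫ : ℝ) : ℂ) * ∑ i, ((⟪ξ, b i⟫ : ℝ) : ℂ) * 𝓕 (ψ i) ξ := by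
  set C : ℂ := (((‖ξ‖ ^ 2)⁻¹ * ⟪w, ξ⟫ : ℝ) : ℂ) with hC
  set Ψ : 𝓢(E, ℂ) := ψw - C • ∑ i, ((⟪ξ, b i⟫ : ℝ) : ℂ) • ψ i with hΨ
  have hfun : (fun x => ((⟪w, leraySymbol ξ (φ x)⟫ : ℝ) : ℂ)) = ⇑Ψ := by
    funext x
    simp only [hΨ, sub_apply, smul_apply, sum_apply, hψw, hψ, smul_eq_mul, leraySymbol_apply,
      inner_sub_right, inner_smul_right]
    rw [← b.sum_inner_mul_inner ξ (φ x), hC]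
    push_cast
    ring
  have hF : 𝓕 Ψ = 𝓕 ψw - C • ∑ i, ((⟪ξ, b i⟫ : ℝ) : ℂ) • 𝓕 (ψ i) := by
    rw [hΨ, sub_eq_add_neg, FourierTransform.fourier_add, FourierTransform.fourier_neg,
      FourierTransform.fourier_smul, FourierTransform.fourier_sum, ← sub_eq_add_neg]
    simp only [FourierTransform.fourier_smul]
  rw [hfun, ← SchwartzMap.fourier_coe, hF]
  simp only [sub_apply, smul_apply, sum_apply, smul_eq_mul]

end TestField

section TestScalar

variable {q : E → ℝ}

omit [FiniteDimensional ℝ E] [MeasurableSpace E] [BorelSpace E] in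
/-- A real test function, complexified, is a Schwartz function (Mathlib
`HasCompactSupport.toSchwartzMap`). [folklore] -/
theorem exists_schwartzMap_coe_eq_ofReal (hq : FunctionSpaces.IsTestFunctionOn (⊤ : Opens E) q) :
    ∃ Q : 𝓢(E, ℂ), ∀ x, Q x = ((q x : ℝ) : ℂ) :=
  ⟨(hq.hasCompactSupport.comp_left (g := Complex.ofRealCLM) (map_zero _)).toSchwartzMap
    (Complex.ofRealCLM.contDiff.comp hq.contDiff), fun _ => rfl⟩

omit [MeasurableSpace E] [BorelSpace E] in
/-- Components of a gradient are line derivatives: `⟪w, ∇q(x)⟫ = ∂_w Q(x)` for the complexified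
`Q = (q : ℂ)` (chain rule and the Riesz identification `⟪∇q(x), w⟫ = Dq(x) w`). [folklore] -/
theorem inner_gradient_eq_lineDerivOp (hq : Differentiable ℝ q) {Q : 𝓢(E, ℂ)}
    (hQ : ∀ x, Q x = ((q x : ℝ) : ℂ)) (w x : E) :
    ((⟪w, gradient q x⟫ : ℝ) : ℂ) = ∂_{w} Q x := by
  rw [SchwartzMap.lineDerivOp_apply_eq_fderiv]
  have hcoe : ⇑Q = Complex.ofRealCLM ∘ q := funext fun x => (hQ x).trans rfl
  rw [hcoe, (Complex.ofRealCLM.hasFDerivAt.comp x (hq x).hasFDerivAt).fderiv, real_inner_comm,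
    gradient, InnerProductSpace.toDual_symm_apply]
  rfl

end TestScalar

end Literature.Analysis.FluidPDE
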